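import Literature.AlgebraicGeometry.HodgeTheory.InvariantClassesFromTotalSpaceLefschetzClass
import Summits.HodgeConjecture.HodgeConjecture.Theorems.Ring2HypothesesFlatSectionsOfPartieFixe
import Summits.HodgeConjecture.HodgeConjecture.Theorems.Ring2HypothesesFlatSectionsLocalization
import HarnessLib

/-!
# Ring 2 — hypotheses layer: `VHC ⟹ FlatSectionsAlgebraic` for every family carrying a degree-2 class with the Lefschetz property on ONE fibre (binder-free); the proper partie fixe reduces to such classes

HONEST FRAMING: research route conditional on HC_CM; not a corollary; Q11.4-sentence-2 already refuted in dim ≥ 3.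

Cell `pub-hodge-ring2`, seat `ring2-b04` (gen 2; binder prover for row b04 of `BINDER-OWNERS.md`:
`Ring2.Hypotheses.FlatSectionsAlgebraic`, `Ring2Hypotheses.lean` §2). `HC_CM` plays no role in this file
and occurs in no statement; nothing here proves a case of the Hodge conjecture. No definition, no
named fact.

## State of row b04 before this part

`FlatSectionsAlgebraic ⟹ VHC` (part I); `VHC ⟹ FlatSectionsAlgebraic` binder-free for families whose total
space is, locally on the base, quasi-projective (seat ring2-b01 `…FlatSectionsBaseReduction` R1, gen 1's
`…FlatSectionsLocalization`), and for ALL families modulo the named fact c15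
`deligne1971_invariantClass_fromTotalSpace_proper` = Deligne, Hodge II, Thm. 4.1.1 (i) for PROPER smooth
`f` (ring2-b01 `…FlatSectionsOfPartieFixe`: `flatSectionsAlgebraic_iff_vhc_of_deligne1971`). The residual
class: smooth proper families with projective fibres NOT locally projective over the base (Atiyah 1958).

## What this part adds

Deligne's 1968 theorem is printed for the Lefschetz condition relative to an ARBITRARY class
`ξ ∈ H²(X)`, and Voisin II Remark 4.16 records that Thm. 4.15/4.18 need only "a cohomology class whose
restriction to a fibre (assuming that `Y` is connected) is a Kähler class". The Literature proof file
`InvariantClassesFromTotalSpaceLefschetzClass` (this seat) proves that form on the tree's carriers: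
`invariantClass_fromTotalSpace_of_lefschetzClassAt` — for a smooth PROPER family with projective fibres
over a smooth irreducible quasi-projective base and `η ∈ H²(𝒳(ℂ); ℂ)` with the hard Lefschetz property
on ONE fibre, every value of a flat section of `Rᵏf_*ℂ` comes from the total space (no projectivity of
`f`, no quasi-projectivity of `𝒳`; the property propagates along flat sections,
`hasHardLefschetzProperty_fiber_of_fiber`). Consequences for the row:

* `exists_globalSection_eq_of_flatSection_of_lefschetzClassAt` — over a smooth irreducible
  quasi-projective base, a flat section of such a family is the section of ONE global class.
* `flatSection_algebraic_of_vhc_of_lefschetzClassAt_of_isQuasiProjectiveOver_base` and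
  **`flatSection_algebraic_of_vhc_of_lefschetzClassAt` — BINDER-FREE: `VHC` (item 1076) gives the
  flat-section form of Conj. 11.3.1 for every smooth proper family with projective fibres, over ANY
  smooth irreducible base, whose total space carries a class `η ∈ H²(𝒳(ℂ); ℂ)` with the hard Lefschetz
  property on one fibre** (reduction to affine opens of the base by gen 1's `flatSection_algebraic_of_local`;
  the restricted class keeps the property through the fibre isomorphisms `(𝒳 ×_S U)_u ≅ 𝒳_{u}`).
  This class of families contains the locally projective ones of the earlier rungs (hyperplane class)
  and is strictly larger in form: `flatSection_algebraic_of_vhc_of_fiberEmbedding` — **every family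
  whose total space maps to some `ℙᵐ` by a morphism embedding ONE fibre** (generically projective
  proper families, e.g. the simultaneous small resolutions of Atiyah 1958 that witness the residual).
* `flatSectionsAlgebraic_of_vhc_of_lefschetzClasses`, `flatSectionsAlgebraic_iff_vhc_of_lefschetzClasses` —
  at NODE level, `FlatSectionsAlgebraic ↔ VHC` modulo the hypothesis that every smooth proper family with
  projective fibres over a smooth irreducible AFFINE base carries a degree-2 class with the hard
  Lefschetz property on one fibre ("cohomological polarization"), in place of c15.
* `deligne1971_invariantClass_fromTotalSpace_proper_of_lefschetzClasses` — the DISCHARGE PATH for c15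
  in the kernel: Hodge II 4.1.1 (i) in its typed form follows from the existence, on every such family
  over a smooth quasi-projective base, of a degree-2 class with the hard Lefschetz property on the
  fibres. (In print such a class exists: a smooth proper morphism with projective fibres is projective
  over a dense open `S' ⊆ S` — very general fibre ≅ geometric generic fibre —, a relatively ample
  bundle on `𝒳_{S'}` extends to a line bundle on the smooth, hence locally factorial, `𝒳`, and its `c₁`
  has the hard Lefschetz property on the fibres over `S'`, hence on all by propagation. None of this is
  claimed in the kernel.)

Sources. C. Voisin, *Hodge Theory II* [VoisinHodgeII2003] Thm. 4.15, Rem. 4.16, Lemma 4.17, Thm. 4.18;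
P. Deligne 1968 [Deligne1968] Thm. 1.5, Prop. 2.1; P. Deligne, Hodge II [DeligneHodgeII1971] Thm. 4.1.1;
F. Charles, C. Schnell [CharlesSchnell2014Notes] Conj. 11.3.1, Thm. 11.3.4, Prop. 11.3.5; M. Atiyah 1958
[Atiyah1958].
-/

-- every declaration of this problem lives in `Summit.HodgeConjecture.HodgeConjecture.…` (summit = sub-problem)
set_option linter.dupNamespace false

noncomputable section

open CategoryTheory AlgebraicGeometry Topology Filter
open Literature.AlgebraicGeometry Literature.AlgebraicGeometry.Motives Literature.AlgebraicGeometry.HodgeTheory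
open Literature.Geometry.Kaehler
open Literature.AlgebraicTopology.SingularHomology

namespace Summit.HodgeConjecture.HodgeConjecture.Ring2.Hypotheses

/-! ## §1 Quasi-projective bases: a flat section is the section of one global class -/

/-- **A flat section over a smooth quasi-projective irreducible base is the section of ONE global class, for a family
carrying a class `η ∈ H²(𝒳(ℂ); ℂ)` with the hard Lefschetz property on one fibre** (`f` proper smooth with projective
fibres; NO projectivity of `f`): the Literature theorem `invariantClass_fromTotalSpace_of_lefschetzClassAt` (Deligne
1968 / Voisin II Thm. 4.18 with Remark 4.16) at one point, then the identity principle
`Theorems.HeckePrymWeilLine.gcs_section_eq_of_eq` for continuous sections of the local system `Rᵏf_*ℂ` over the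
connected manifold `S(ℂ)`. [cite: VoisinHodgeII2003, Thm. 4.18, Remark 4.16 and Lemma 4.17]
[cite: Deligne1968, Thm. 1.5 and Prop. 2.1] -/
theorem exists_globalSection_eq_of_flatSection_of_lefschetzClassAt {n : ℕ} {𝒳 S : SchemeOver ℂ} (f : 𝒳 ⟶ S)
    (hf : IsSmoothProjectiveFamily f n) (hS : IsQuasiProjectiveOver S)
    (hirr : IrreducibleSpace S.left) (hsm : AlgebraicGeometry.Smooth S.hom)
    (η : complexBetti 𝒳 2) {s₁ : ComplexPoints S}
    (hη : HasHardLefschetzProperty (complexBetti.map (fiberι f s₁) 2 η) n) (k : ℕ)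
    {σ : ComplexPoints S → FiberClass f k} (hσ : Continuous σ) (hpt : ∀ s, (σ s).pt = s) :
    ∃ β : complexBetti 𝒳 k, ∀ s, σ s = globalSection f k β s := by
  haveI := hsm
  haveI := hirr
  haveI : LocallyOfFiniteType S.hom := hS.locallyOfFiniteType
  haveI : ConnectedSpace (ComplexPoints S) := (ComplexPoints.connectedSpace_iff_holds S).2 inferInstance
  obtain ⟨d, hd⟩ := exists_smoothOfRelativeDimension_of_connectedSpace_complexPoints S
  haveI := hd
  haveI := pathConnectedSpace_complexPoints_of_smoothOfRelativeDimension S d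
  have hU := isCohomologicallyLocallyTrivialOn_univ_of_isSmoothProjectiveFamily f d hf hS
  obtain ⟨s₀⟩ := (inferInstance : Nonempty (ComplexPoints S))
  obtain ⟨β, hβ⟩ := invariantClass_fromTotalSpace_of_lefschetzClassAt f hf hS η hη k hσ hpt s₀
  exact ⟨β, Theorems.HeckePrymWeilLine.gcs_section_eq_of_eq f k hU hσ hpt (continuous_globalSection f k β)
    (fun _ => rfl) hβ⟩

/-- **Quasi-projective bases**: `VHC` (item stmt-HodgeConjecture-1076) gives the flat-section transport for every
smooth proper family with projective fibres over a smooth irreducible quasi-projective base whose total space carries a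
degree-`2` class with the hard Lefschetz property on one fibre — the flat section is the section of one global class
`β`, fibrewise rational `(p,p)` and algebraic at the anchor, so `VHC` transports. BINDER-FREE (no named fact).
[cite: VoisinHodgeII2003, Thm. 4.18 and Remark 4.16] [cite: CharlesSchnell2014Notes, proof of Prop. 11.3.5] -/
theorem flatSection_algebraic_of_vhc_of_lefschetzClassAt_of_isQuasiProjectiveOver_base
    (hV : Theses.AnchorTransport.VariationalHodge)
    ⦃n : ℕ⦄ ⦃𝒳 S : SchemeOver ℂ⦄ (f : 𝒳 ⟶ S) (hf : IsSmoothProjectiveFamily f n) (hS : IsQuasiProjectiveOver S)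
    (hirr : IrreducibleSpace S.left) (hsm : AlgebraicGeometry.Smooth S.hom)
    (η : complexBetti 𝒳 2) {s₁ : ComplexPoints S}
    (hη : HasHardLefschetzProperty (complexBetti.map (fiberι f s₁) 2 η) n)
    (p : ℕ) (σ : ComplexPoints S → FiberClass f (2 * p)) (hσ : Continuous σ) (hpt : ∀ s, (σ s).pt = s)
    (hH : ∀ s, σ s ∈ locusOfHodgeClasses f n p)
    (h₀ : ∃ s₀, (σ s₀).cls ∈ algebraicClasses (fiberOver f (σ s₀).pt) p) (s : ComplexPoints S) :
    (σ s).cls ∈ algebraicClasses (fiberOver f (σ s).pt) p := by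
  obtain ⟨s₀, hs₀⟩ := h₀
  obtain ⟨β, hσβ⟩ := exists_globalSection_eq_of_flatSection_of_lefschetzClassAt f hf hS hirr hsm η hη (2 * p) hσ hpt
  have hA : ∀ t : ComplexPoints S, IsRationalClass (complexBetti.map (fiberι f t) (2 * p) β) ∧
      IsOfHodgeType n (fiberOver f t) (2 * p) p p (complexBetti.map (fiberι f t) (2 * p) β) := fun t =>
    fiberClass_transfer_of_eq_mk (hσβ t)
      (fun t c => IsRationalClass c ∧ IsOfHodgeType n (fiberOver f t) (2 * p) p p c)
      ((mem_locusOfHodgeClasses_iff _).1 (hH t))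
  have hβ₀ : complexBetti.map (fiberι f s₀) (2 * p) β ∈ algebraicClasses (fiberOver f s₀) p :=
    fiberClass_transfer_of_eq_mk (hσβ s₀) (fun t c => c ∈ algebraicClasses (fiberOver f t) p) hs₀
  exact fiberClass_transfer_to_eq_mk (hσβ s) (fun t c => c ∈ algebraicClasses (fiberOver f t) p)
    (hV f hf hirr hsm p β hA ⟨s₀, hβ₀⟩ s)

/-! ## §2 Any smooth irreducible base -/

section AnyBase

variable {n : ℕ} {𝒳 S : SchemeOver ℂ} (f : 𝒳 ⟶ S)

/-- **Restricting the family to an open of the base keeps the Lefschetz property of the restricted class**: for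
`g : S' ⟶ S` and `u ∈ S'(ℂ)`, the restriction of `(𝒳 ×_S S' ⟶ 𝒳)^* η` to the fibre `(𝒳 ×_S S')_u` is the pull-back
of `η|_{𝒳_{g u}}` along the fibre isomorphism `(𝒳 ×_S S')_u ≅ 𝒳_{g u}` (`fiberOverFamilyPullbackIso`), and the hard
Lefschetz property transports along isomorphisms (`HasHardLefschetzProperty.map_of_iso`).
[cite: VoisinHodgeII2003, §3.1.2 and Remark 4.16] -/
theorem hasHardLefschetzProperty_map_fiberι_familyPullback {S' : SchemeOver ℂ} (g : S' ⟶ S)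
    (η : complexBetti 𝒳 2) {d : ℕ} (u : ComplexPoints S')
    (hη : HasHardLefschetzProperty (complexBetti.map (fiberι f (AlgPoints.map g u)) 2 η) d) :
    HasHardLefschetzProperty
      (complexBetti.map (fiberι (familyPullback.snd f g) u) 2 (complexBetti.map (familyPullback.fst f g) 2 η)) d := by
  have hcomp : complexBetti.map (fiberι (familyPullback.snd f g) u) 2 (complexBetti.map (familyPullback.fst f g) 2 η) =
      complexBetti.map (fiberOverFamilyPullbackIso f g u).hom 2
        (complexBetti.map (fiberι f (AlgPoints.map g u)) 2 η) := by
    rw [← ModuleCat.comp_apply, ← ModuleCat.comp_apply, ← complexBetti.map_comp, ← complexBetti.map_comp,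
      fiberOverFamilyPullbackIso_hom_fiberι]
  rw [hcomp]
  exact HasHardLefschetzProperty.map_of_iso (fiberOverFamilyPullbackIso f g u) hη

/-- **BINDER-FREE: `VHC` (item stmt-HodgeConjecture-1076) gives the flat-section form of Conj. 11.3.1 for every smooth
proper family with projective fibres, over ANY smooth irreducible base, whose total space carries a class
`η ∈ H²(𝒳(ℂ); ℂ)` with the hard Lefschetz property on ONE fibre.** Proof: the property propagates to every fibre
(`hasHardLefschetzProperty_fiber_of_fiber_of_irreducible`: `R²f_*ℂ` is a local system over any smooth base and
`S(ℂ)` is connected); the statement is local on the base (gen 1's `flatSection_algebraic_of_local`); over an AFFINE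
open `U` (quasi-projective, irreducible, smooth) the restricted family `𝒳 ×_S U ⟶ U` carries the restricted class,
still with the property on its fibres (`hasHardLefschetzProperty_map_fiberι_familyPullback`), and §1 applies. This
class of families contains every locally projective one (hyperplane class) — the earlier binder-free rungs — and the
generically projective proper families of the residual (`flatSection_algebraic_of_vhc_of_fiberEmbedding`). No named
fact: Deligne 1968 enters through the tree THEOREM `invariantClass_fromTotalSpace_of_lefschetzClassAt`.
[cite: VoisinHodgeII2003, Thm. 4.18 and Remark 4.16] [cite: CharlesSchnell2014Notes, Conj. 11.3.1 and proof of Prop. 11.3.5] -/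
theorem flatSection_algebraic_of_vhc_of_lefschetzClassAt (hV : Theses.AnchorTransport.VariationalHodge)
    (hf : IsSmoothProjectiveFamily f n) [IrreducibleSpace S.left] [AlgebraicGeometry.Smooth S.hom]
    (η : complexBetti 𝒳 2) {s₁ : ComplexPoints S}
    (hη : HasHardLefschetzProperty (complexBetti.map (fiberι f s₁) 2 η) n)
    (p : ℕ) {σ : ComplexPoints S → FiberClass f (2 * p)} (hσ : Continuous σ) (hpt : ∀ s, (σ s).pt = s)
    (hH : ∀ s, σ s ∈ locusOfHodgeClasses f n p)
    (h₀ : ∃ s₀, (σ s₀).cls ∈ algebraicClasses (fiberOver f (σ s₀).pt) p) (s : ComplexPoints S) :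
    (σ s).cls ∈ algebraicClasses (fiberOver f (σ s).pt) p := by
  -- the Lefschetz property on every fibre
  have hall : ∀ t : ComplexPoints S, HasHardLefschetzProperty (complexBetti.map (fiberι f t) 2 η) n :=
    hasHardLefschetzProperty_fiber_of_fiber_of_irreducible f hf η n hη
  -- an affine open cover of the base
  have hloc : ∀ x : S.left, ∃ U : S.left.Opens, x ∈ U ∧ IsAffineOpen U := fun x => by
    obtain ⟨U, hU, hxU, -⟩ := exists_isAffineOpen_mem_and_subset (U := ⊤) (x := x) trivial
    exact ⟨U, hxU, hU⟩
  choose 𝒰 h𝒰 hA𝒰 using hloc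
  refine flatSection_algebraic_of_local f hf 𝒰 h𝒰 (fun x τ hτ hptτ hHτ h₀τ u => ?_) hσ hpt hH h₀ s
  haveI : IsOpenImmersion (openSubschemeOverι S (𝒰 x)).left := inferInstanceAs (IsOpenImmersion (𝒰 x).ι)
  haveI : IsAffine (openSubschemeOver S (𝒰 x)).left := hA𝒰 x
  have hsm : AlgebraicGeometry.Smooth (openSubschemeOver S (𝒰 x)).hom := by
    change AlgebraicGeometry.Smooth ((𝒰 x).ι ≫ S.hom)
    infer_instance
  haveI := hsm
  haveI : LocallyOfFiniteType (openSubschemeOver S (𝒰 x)).hom := inferInstance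
  obtain ⟨u₀, hu₀⟩ := h₀τ
  exact flatSection_algebraic_of_vhc_of_lefschetzClassAt_of_isQuasiProjectiveOver_base hV
    (familyPullback.snd f (openSubschemeOverι S (𝒰 x))) (hf.familyPullback_snd _)
    (IsQuasiProjectiveOver.of_isAffine _) (irreducibleSpace_openSubschemeOver (𝒰 x) (h𝒰 x)) hsm
    (complexBetti.map (familyPullback.fst f (openSubschemeOverι S (𝒰 x))) 2 η)
    (hasHardLefschetzProperty_map_fiberι_familyPullback f (openSubschemeOverι S (𝒰 x)) η u₀ (hall _))
    p τ hτ hptτ hHτ ⟨u₀, hu₀⟩ u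

/-- **BINDER-FREE: `VHC` gives the flat-section form of Conj. 11.3.1 for every smooth proper family with projective
fibres whose total space maps to some `ℙᵐ` by a morphism embedding ONE fibre**, over any smooth irreducible base:
`ε : 𝒳 ⟶ ℙᵐ` with `𝒳_{s₁} ⟶ 𝒳 ⟶ ℙᵐ` a closed immersion for one `s₁` (e.g. `ε` an immersion away from finitely many
fibres — generically projective proper families such as the simultaneous small resolutions of Atiyah 1958, where the
pull-back of the hyperplane bundle is big and nef but not ample on the resolved fibre; `𝒳` itself need not be
quasi-projective). The class `ε(ℂ)^* r₀` of a generator of `H²(ℙᵐ(ℂ); ℂ)` has the hard Lefschetz property on the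
embedded fibre (`exists_forall_hasHardLefschetzProperty_map`, Voisin I Thm. 6.25).
[cite: VoisinHodgeII2003, Def. 4.14, Thm. 4.18 and Remark 4.16] [cite: Atiyah1958, §4]
[cite: CharlesSchnell2014Notes, Conj. 11.3.1] -/
theorem flatSection_algebraic_of_vhc_of_fiberEmbedding (hV : Theses.AnchorTransport.VariationalHodge)
    (hf : IsSmoothProjectiveFamily f n) [IrreducibleSpace S.left] [AlgebraicGeometry.Smooth S.hom]
    {m : ℕ} (ε : 𝒳 ⟶ projectiveSpace m ℂ) (s₁ : ComplexPoints S) [IsClosedImmersion (fiberι f s₁ ≫ ε).left]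
    (p : ℕ) {σ : ComplexPoints S → FiberClass f (2 * p)} (hσ : Continuous σ) (hpt : ∀ s, (σ s).pt = s)
    (hH : ∀ s, σ s ∈ locusOfHodgeClasses f n p)
    (h₀ : ∃ s₀, (σ s₀).cls ∈ algebraicClasses (fiberOver f (σ s₀).pt) p) (s : ComplexPoints S) :
    (σ s).cls ∈ algebraicClasses (fiberOver f (σ s).pt) p := by
  obtain ⟨r₀, hr₀⟩ := exists_forall_hasHardLefschetzProperty_map m
  have h₁ := hr₀ (hf.isSmoothProjective s₁) (fiberι f s₁ ≫ ε)
  rw [AlgPoints.mapContinuous_comp, singularCohomology.map_comp, ModuleCat.comp_apply] at h₁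
  exact flatSection_algebraic_of_vhc_of_lefschetzClassAt f hV hf (complexBetti.map ε 2 r₀) h₁ p hσ hpt hH h₀ s

end AnyBase

/-! ## §3 Node level: `FlatSectionsAlgebraic ↔ VHC` modulo cohomological polarization, and the discharge path for c15 -/

/-- **`VHC ⟹ FlatSectionsAlgebraic` restricted to families carrying a degree-2 class with the hard Lefschetz property
on one fibre, stated at the level of the nodes** (all `n`, all smooth irreducible bases).
[cite: CharlesSchnell2014Notes, Conj. 11.3.1] [cite: VoisinHodgeII2003, Remark 4.16] -/
theorem flatSections_lefschetzClassAt_of_vhc (hV : Theses.AnchorTransport.VariationalHodge) :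
    ∀ ⦃n : ℕ⦄ ⦃𝒳 S : SchemeOver ℂ⦄ (f : 𝒳 ⟶ S), IsSmoothProjectiveFamily f n → IrreducibleSpace S.left →
      AlgebraicGeometry.Smooth S.hom →
      (∃ (η : complexBetti 𝒳 2) (s₁ : ComplexPoints S),
        HasHardLefschetzProperty (complexBetti.map (fiberι f s₁) 2 η) n) →
      ∀ (p : ℕ) (σ : ComplexPoints S → FiberClass f (2 * p)),
      Continuous σ → (∀ s, (σ s).pt = s) → (∀ s, σ s ∈ locusOfHodgeClasses f n p) →
      (∃ s₀, (σ s₀).cls ∈ algebraicClasses (fiberOver f (σ s₀).pt) p) →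
      ∀ s, (σ s).cls ∈ algebraicClasses (fiberOver f (σ s).pt) p :=
  fun _ _ _ f hf hirr hsm hL p _ hσ hpt hH h₀ s => by
    haveI := hirr
    haveI := hsm
    obtain ⟨η, s₁, hη⟩ := hL
    exact flatSection_algebraic_of_vhc_of_lefschetzClassAt f hV hf η hη p hσ hpt hH h₀ s

/-- **`VHC ∧ [cohomological polarization over affine bases] ⟹ FlatSectionsAlgebraic`** — row b04 from row b03 with
the Hodge-II fact c15 replaced by the hypothesis `hL`: every smooth proper family with projective fibres over a smooth
irreducible AFFINE `ℂ`-scheme carries a class `η ∈ H²(𝒳(ℂ); ℂ)` with the hard Lefschetz property on one fibre (true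
for locally projective and for generically embedded families by the theorems above; in print for all, by generic
projectivity and extension of line bundles over the smooth total space — not claimed here). Reduction to affine
bases: ring2-b01's `flatSectionsAlgebraic_of_affine`. `HC_CM` plays no role.
[cite: CharlesSchnell2014Notes, Conj. 11.3.1 and Prop. 11.3.5] [cite: VoisinHodgeII2003, Remark 4.16] -/
theorem flatSectionsAlgebraic_of_vhc_of_lefschetzClasses
    (hL : ∀ ⦃n : ℕ⦄ ⦃𝒳 S : SchemeOver ℂ⦄ (f : 𝒳 ⟶ S), IsSmoothProjectiveFamily f n →
      IrreducibleSpace S.left → IsAffine S.left → AlgebraicGeometry.Smooth S.hom →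
      ∃ (η : complexBetti 𝒳 2) (s₁ : ComplexPoints S),
        HasHardLefschetzProperty (complexBetti.map (fiberι f s₁) 2 η) n)
    (hV : Theses.AnchorTransport.VariationalHodge) : FlatSectionsAlgebraic :=
  flatSectionsAlgebraic_of_affine fun _ _ _ f hf hirr haff hsm p σ hσ hpt hH h₀ s => by
    haveI := hirr
    haveI := hsm
    obtain ⟨η, s₁, hη⟩ := hL f hf hirr haff hsm
    exact flatSection_algebraic_of_vhc_of_lefschetzClassAt f hV hf η hη p hσ hpt hH h₀ s

/-- **Modulo cohomological polarization over affine bases, the flat-section node and the global-class node are ONE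
node: `FlatSectionsAlgebraic ↔ VHC`** (with part I's `vhc_of_flatSectionsAlgebraic`) — the twin of ring2-b01's
`flatSectionsAlgebraic_iff_vhc_of_deligne1971` with a topological hypothesis in place of Hodge II 4.1.1 (i).
[cite: CharlesSchnell2014Notes, Conj. 11.3.1 and Prop. 11.3.5] [cite: VoisinHodgeII2003, Remark 4.16] -/
theorem flatSectionsAlgebraic_iff_vhc_of_lefschetzClasses
    (hL : ∀ ⦃n : ℕ⦄ ⦃𝒳 S : SchemeOver ℂ⦄ (f : 𝒳 ⟶ S), IsSmoothProjectiveFamily f n →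
      IrreducibleSpace S.left → IsAffine S.left → AlgebraicGeometry.Smooth S.hom →
      ∃ (η : complexBetti 𝒳 2) (s₁ : ComplexPoints S),
        HasHardLefschetzProperty (complexBetti.map (fiberι f s₁) 2 η) n) :
    FlatSectionsAlgebraic ↔ Theses.AnchorTransport.VariationalHodge :=
  ⟨vhc_of_flatSectionsAlgebraic, flatSectionsAlgebraic_of_vhc_of_lefschetzClasses hL⟩

/-- **The discharge path for c15 in the kernel: Deligne's proper partie fixe (Hodge II, Thm. 4.1.1 (i), as typed in
`deligne1971_invariantClass_fromTotalSpace_proper`) follows from the existence, on every smooth proper family with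
projective fibres over a smooth quasi-projective base, of a degree-2 class on the total space with the hard Lefschetz
property on the fibres** — by the Literature theorem `invariantClass_fromTotalSpace_of_lefschetzClass` (Deligne 1968
in the generality of Voisin II Remark 4.16). What projectivity of `f` contributes to Thm. 4.18 is such a class and
nothing else. [cite: DeligneHodgeII1971, Théorème 4.1.1 (i)] [cite: VoisinHodgeII2003, Thm. 4.18 and Remark 4.16]
[cite: Deligne1968, Thm. 1.5 and Prop. 2.1] -/
theorem deligne1971_invariantClass_fromTotalSpace_proper_of_lefschetzClasses
    (hL : ∀ (𝒳 S : SchemeOver ℂ) (f : 𝒳 ⟶ S) (n : ℕ), IsSmoothProjectiveFamily f n → IsQuasiProjectiveOver S →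
      AlgebraicGeometry.Smooth S.hom →
      ∃ η : complexBetti 𝒳 2, ∀ s : ComplexPoints S, HasHardLefschetzProperty (complexBetti.map (fiberι f s) 2 η) n) :
    deligne1971_invariantClass_fromTotalSpace_proper := by
  intro 𝒳 S f n hf hS hsm k σ hσ hpt s₀
  haveI := hsm
  obtain ⟨η, hη⟩ := hL 𝒳 S f n hf hS hsm
  exact invariantClass_fromTotalSpace_of_lefschetzClass f hf hS η hη k hσ hpt s₀

/-! ## Audit: no NAMED FACT is used by the binder-free theorems (§1–§2, `flatSections_lefschetzClassAt_of_vhc`);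
`deligne1971_invariantClass_fromTotalSpace_proper` occurs only as the CONCLUSION of the last theorem; no `sorry`;
`HC_CM` does not occur; standard axioms only. -/

#print axioms Summit.HodgeConjecture.HodgeConjecture.Ring2.Hypotheses.flatSection_algebraic_of_vhc_of_lefschetzClassAt
#print axioms Summit.HodgeConjecture.HodgeConjecture.Ring2.Hypotheses.flatSection_algebraic_of_vhc_of_fiberEmbedding
#print axioms Summit.HodgeConjecture.HodgeConjecture.Ring2.Hypotheses.flatSectionsAlgebraic_iff_vhc_of_lefschetzClasses
#print axioms Summit.HodgeConjecture.HodgeConjecture.Ring2.Hypotheses.deligne1971_invariantClass_fromTotalSpace_proper_of_lefschetzClasses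

end Summit.HodgeConjecture.HodgeConjecture.Ring2.Hypotheses

end
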